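import Summits.CriticalPhenomena.PercolationContinuityZ3.Theorems.PercNearOneGluingNoHeavyQuantBlockCombCantelliRow
import Summits.CriticalPhenomena.PercolationContinuityZ3.Theorems.PercNearOneGluingNoHeavyQuantBlockCombClass
import Summits.CriticalPhenomena.PercolationContinuityZ3.Theorems.PercNearOneGluingNoHeavyQuantBlockCombTwoPlateauRoot
import HarnessLib

/-!
# QUANT lane R8, FAR on trees: two more moves of the block-comb reduction scheme in the kernel
# (the tail is monotone in the SIZES; the single-set product WITNESS at any depth)

builds on p205010 (kernel theorem, internal audit signed; external expert review pending)

Support file (`--supports stmt-CriticalPhenomena-4575`), QUANT lane seat prim-quant-census-2 (gen 48); memo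
`run/shared/lean/prim/quant/prim-quant-census-2-g48/TIED-PLUS-TWO-G48.md` §5.  Theorems only (local notation, no definitions), no sorries, standard axioms.
Model/notation: `…QuantBlockCombMergeModel.lean`; tools: `sum_wt_mono_gates` (lead g12, `…QuantBlockCombClass`), `tail_succ_ge_rootGate_mul` (lead g13, `…QuantBlockCombTwoPlateauRoot`),
`tail_ge_prefixProd_mul_level` (`…QuantBlockCombCantelliRow`).

WHY.  Memo §5: numerically, every sampled budget-binding block-comb admits one of {giant, tied-root merge, affine slide, root contraction, DELETE light blobs +
contract, single-set product WITNESS, Cantelli at one depth}.  The merge, the slide, the contraction/root split and the Cantelli row are kernel; this file adds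
the two elementary monotonicity facts the remaining two moves rest on, so that a completeness theorem (if found) closes the general block-comb row from kernel parts.

* `Quant.BlockComb.tail_mono_sizes` — if `a' k ≤ a k` for every blob then `TAIL[a'] ≤ TAIL[a]` (deleting or shrinking blobs lowers the tail; the crossing event is
  increasing in the sizes).  With lead g13's root split `tail_succ_ge_rootGate_mul` this is the 'delete + contract' move:
  `TAIL[D+1, q, a] ≥ TAIL[D+1, q, a'] ≥ q 0·TAIL[D, q∘succ, lv−1, a']` for the instance `a'` with the light root blobs deleted.
* `Quant.BlockComb.tail_ge_set_witness` — for a finset `V` of blobs with `Σ_{k∈V} a k ≥ j+1`, all at levels `≤ l ≤ D`: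
  `(∏_{i<l} q i)·∏_{k∈V} g k ≤ TAIL` (the chain reaches depth `l` and every blob of `V` is open).  `tail_ge_pair_witness` (`…PairWitness`) is the case `V = {s₀, s₁}`.
[this work]
-/

namespace Summit.CriticalPhenomena.PercolationContinuityZ3.Theorems

namespace Quant

namespace BlockComb

open Finset

variable {κ : Type*} [Fintype κ] [DecidableEq κ]

/-- product-Bernoulli weight of the set `S` of open blob gates -/
local notation3 "wt[" g ", " S "]" => ∏ k, (if k ∈ (S : Finset κ) then (g : κ → ℝ) k else 1 - (g : κ → ℝ) k)

/-- probability that the chain `q` of length `D` is open exactly to depth `i` -/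
local notation3 "pd[" D ", " q ", " i "]" =>
  (∏ i' ∈ Finset.range (i : ℕ), (q : ℕ → ℝ) i') * (if (i : ℕ) < (D : ℕ) then 1 - (q : ℕ → ℝ) i else 1)

/-- mass counted at depth `i` in blob configuration `S` -/
local notation3 "mass[" lv ", " a ", " i ", " S "]" =>
  ∑ k ∈ (S : Finset κ).filter (fun k => (lv : κ → ℕ) k ≤ (i : ℕ)), ((a : κ → ℕ) k : ℕ)

/-- the tail `P(N ≥ j+1)` of the block-comb count, as an explicit finite sum -/
local notation3 "TAIL[" D ", " q ", " lv ", " a ", " g ", " j "]" =>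
  ∑ i ∈ Finset.range ((D : ℕ) + 1), pd[D, q, i] *
    ∑ S : Finset κ, wt[g, S] * (if (j : ℕ) + 1 ≤ mass[lv, a, i, S] then (1 : ℝ) else 0)

/-- the level-`l` crossing probability `Φ_l = Σ_S wt S·𝟙[j+1 ≤ mass_l S]` -/
local notation3 "CROSS[" lv ", " a ", " g ", " j ", " l "]" =>
  ∑ S : Finset κ, wt[g, S] * (if (j : ℕ) + 1 ≤ mass[lv, a, l, S] then (1 : ℝ) else 0)

/-! ### 1. The tail is monotone in the sizes -/

omit [Fintype κ] [DecidableEq κ] in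
/-- The mass of a configuration is monotone in the sizes. [folklore] -/
theorem mass_mono_sizes (lv : κ → ℕ) (a a' : κ → ℕ) (ha : ∀ k, a' k ≤ a k) (i : ℕ) (S : Finset κ) :
    mass[lv, a', i, S] ≤ mass[lv, a, i, S] :=
  Finset.sum_le_sum fun k _ => ha k

/-- **The tail is monotone in the sizes**: shrinking or deleting blobs (pointwise `a' ≤ a`) lowers `P(N ≥ j+1)`. [this work] -/
theorem tail_mono_sizes (D : ℕ) (q : ℕ → ℝ) (hq : ∀ i, 0 ≤ q i ∧ q i ≤ 1) (lv : κ → ℕ) (a a' : κ → ℕ)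
    (ha : ∀ k, a' k ≤ a k) (g : κ → ℝ) (hg : ∀ k, 0 ≤ g k ∧ g k ≤ 1) (j : ℕ) :
    TAIL[D, q, lv, a', g, j] ≤ TAIL[D, q, lv, a, g, j] := by
  refine Finset.sum_le_sum fun i _ => mul_le_mul_of_nonneg_left ?_ (pd_nonneg D q hq i)
  refine Finset.sum_le_sum fun S _ => mul_le_mul_of_nonneg_left ?_ (wt_nonneg g hg S)
  by_cases h : j + 1 ≤ mass[lv, a', i, S]
  · rw [if_pos h, if_pos (h.trans (mass_mono_sizes lv a a' ha i S))]
  · rw [if_neg h]; split_ifs <;> norm_num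

/-- **Delete + contract.**  For sizes `a' ≤ a` (the deleted instance): `q 0·TAIL[D, q∘succ, lv−1, a'] ≤ TAIL[D+1, q, lv, a]` — shrink, then root-split.
(Use: delete the blobs whose gate is below the contracted floor `x/q 0`; if the contracted instance still has budget `> 2j`, FAR for it at `x/q 0` gives FAR here.)
[this work] -/
theorem tail_ge_rootGate_mul_deleted (D : ℕ) (q : ℕ → ℝ) (hq : ∀ i, 0 ≤ q i ∧ q i ≤ 1) (lv : κ → ℕ) (a a' : κ → ℕ)
    (ha : ∀ k, a' k ≤ a k) (g : κ → ℝ) (hg : ∀ k, 0 ≤ g k ∧ g k ≤ 1) (j : ℕ) :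
    q 0 * TAIL[D, (fun i => q (i + 1)), (fun k => lv k - 1), a', g, j] ≤ TAIL[D + 1, q, lv, a, g, j] :=
  (tail_succ_ge_rootGate_mul D q hq lv a' g hg j).trans (tail_mono_sizes (D + 1) q hq lv a a' ha g hg j)

/-! ### 2. The single-set product witness -/

/-- **Set witness at a fixed depth.**  If `V` has total size `≥ j+1` and all its blobs sit at levels `≤ l`, then `∏_{k∈V} g k ≤ Φ_l`: lower every gate
outside `V` to `0` (`sum_wt_mono_gates`); the configuration `V` alone then has weight `∏_{k∈V} g k` and crosses. [this work] -/
theorem levelCross_ge_prod_of_set (lv : κ → ℕ) (a : κ → ℕ) (g : κ → ℝ) (hg : ∀ k, 0 ≤ g k ∧ g k ≤ 1) (j l : ℕ)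
    (V : Finset κ) (hV : j + 1 ≤ ∑ k ∈ V, a k) (hl : ∀ k ∈ V, lv k ≤ l) :
    ∏ k ∈ V, g k ≤ CROSS[lv, a, g, j, l] := by
  set g' : κ → ℝ := fun k => if k ∈ V then g k else 0 with hg'def
  have hg' : ∀ k, 0 ≤ g' k ∧ g' k ≤ 1 := by
    intro k
    by_cases h : k ∈ V
    · rw [hg'def]; simp only [h, if_true]; exact hg k
    · rw [hg'def]; simp only [h, if_false]; norm_num
  have hle : ∀ k, g' k ≤ g k := by
    intro k
    by_cases h : k ∈ V
    · rw [hg'def]; simp only [h, if_true]; exact le_rfl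
    · rw [hg'def]; simp only [h, if_false]; exact (hg k).1
  have hmono := sum_wt_mono_gates g g' hg hg' hle
    (fun S => if j + 1 ≤ mass[lv, a, l, S] then (1 : ℝ) else 0) (fun S T hST => crossIndicator_mono lv a l j S T hST)
  refine le_trans ?_ hmono
  -- the weight of `V` under `g'` is `∏_{k∈V} g k`, and `V` crosses at depth `l`
  have hwV : wt[g', V] = ∏ k ∈ V, g k := by
    show (∏ k, (if k ∈ V then g' k else 1 - g' k)) = ∏ k ∈ V, g k
    have h1 : ∀ k, (if k ∈ V then g' k else 1 - g' k) = (if k ∈ V then g k else 1) := by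
      intro k
      by_cases h : k ∈ V
      · rw [if_pos h, if_pos h, hg'def]; simp [h]
      · rw [if_neg h, if_neg h, hg'def]; simp [h]
    rw [Finset.prod_congr rfl fun k _ => h1 k, Finset.prod_ite_mem, Finset.univ_inter]
  have hmass : j + 1 ≤ mass[lv, a, l, V] := by
    have hfilt : V.filter (fun k => lv k ≤ l) = V := Finset.filter_true_of_mem fun k hk => hl k hk
    show j + 1 ≤ ∑ k ∈ V.filter (fun k => lv k ≤ l), a k
    rw [hfilt]; exact hV
  calc ∏ k ∈ V, g k = wt[g', V] * (if j + 1 ≤ mass[lv, a, l, V] then (1 : ℝ) else 0) := by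
        rw [hwV, if_pos hmass, mul_one]
    _ ≤ ∑ S : Finset κ, wt[g', S] * (if j + 1 ≤ mass[lv, a, l, S] then (1 : ℝ) else 0) :=
        Finset.single_le_sum (f := fun S : Finset κ => wt[g', S] * (if j + 1 ≤ mass[lv, a, l, S] then (1 : ℝ) else 0))
          (fun S _ => mul_nonneg (wt_nonneg g' hg' S) (by split_ifs <;> norm_num)) (Finset.mem_univ _)

/-- **Single-set product witness (canonical block-comb model).**  Chain and private gates in `[0,1]`; a finset `V` of blobs with `Σ_{k∈V} a k ≥ j+1`, all
at levels `≤ l ≤ D`.  Then `(∏_{i<l} q i)·∏_{k∈V} g k ≤ TAIL`. [this work] -/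
theorem tail_ge_set_witness (D : ℕ) (q : ℕ → ℝ) (hq : ∀ i, 0 ≤ q i ∧ q i ≤ 1) (lv : κ → ℕ) (a : κ → ℕ)
    (g : κ → ℝ) (hg : ∀ k, 0 ≤ g k ∧ g k ≤ 1) (j l : ℕ) (hlD : l ≤ D)
    (V : Finset κ) (hV : j + 1 ≤ ∑ k ∈ V, a k) (hl : ∀ k ∈ V, lv k ≤ l) :
    (∏ i ∈ Finset.range l, q i) * ∏ k ∈ V, g k ≤ TAIL[D, q, lv, a, g, j] := by
  have hP : 0 ≤ ∏ i ∈ Finset.range l, q i := Finset.prod_nonneg fun i _ => (hq i).1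
  exact (mul_le_mul_of_nonneg_left (levelCross_ge_prod_of_set lv a g hg j l V hV hl) hP).trans
    (tail_ge_prefixProd_mul_level D q hq lv a g hg j l hlD)

end BlockComb

end Quant

end Summit.CriticalPhenomena.PercolationContinuityZ3.Theorems
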